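import Literature.Barriers.CriticalPhenomena.TimarBadClusters
import Literature.Barriers.CriticalPhenomena.TimarRandomGraphs
import Literature.Barriers.CriticalPhenomena.TimarForestTargets
import Literature.Barriers.CriticalPhenomena.TimarOnePartition
import Literature.Barriers.CriticalPhenomena.TimarExhaustionBound
import Literature.Barriers.CriticalPhenomena.SubexponentialGrowthZdCoupling
import HarnessLib

/-!
# The forest on the encounter points of the bad clusters: Lemma 5.3(b) and "degree ≥ 3"
# (Timár 2006, §5, Lemma 5.3 and proof of Thm. 5.5) — PROVED

Barrier catalogue `Literature/Barriers/CriticalPhenomena/`; the penultimate brick of the programme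
proving Timár's Thm. 5.5 (`Timar2006_finiteLevelUnion`, `TimarCriticalNonunimodular.lean`).

The space of this file is `Ω₁ = Coupling V × UnitAddCircle`: the percolation `ω = ω_p(ξ)` with its
tie-breaking labels (`SubexponentialGrowthZdCoupling.lean`) and the phase `U` of the 1-partition
(`TimarOnePartition.lean`, `OnePartitionRel`), with the product probability measure and the diagonal action of
`Aut(G)` (`forestAct`, measure-preserving: `forestMeasure_map_forestAct`). On it:

* `encPoints ξ = W` — the encounter points (`IsEncounter`, `TimarEncounterPoints.lean`) of the bad
  heavy clusters (`IsHeavy ∧ LevelBad`, `TimarBadClusters.lean`); `SameCls ξ` — "same class of the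
  1-partition";
  `tieLabel ξ` — the labels; `FPoints ξ x t` / `forest ξ` — the pointing relation and the forest
  `M` of `TimarTargetForest.lean` on these data ("For every `v ∈ W` and each component `I` … choose
  … a vertex of `I` that is closest to `v` in `ω`. Put a directed edge from `v` to this vertex");
  measurability and equivariance of all of these;
* **Lemma 5.3(b), PROVED** (`ae_exists_encPoint_in_branch`): almost surely, for every `x ∈ W` and
  every heavy component `C` of `C(x) ∖ {x}`, `C` contains a point of `W` in the class of `x`. Proof
  as printed, by the mass transport "let each vertex `y` contained in such a `C ∩ L₀` send mass `1`
  to `x`" (`FSnd`, the sender rule; `Snd.unique`: at most one recipient), whose fibres are almost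
  surely finite (`ae_finite_fiber`, `TimarMassTransport.lean`) yet would contain `C ∩ L₀`, which is
  infinite "by deletion tolerance and Lemma 5.2" (`ae_infinite_branchSet_inter_class`, from
  `ae_infinite_branchSet_inter_weightSlab` and Fubini over the phase);
* **"every point `x` in `F` has degree `≥ 3`", PROVED** (`ae_three_le_encard_fpoints`): almost
  surely every `x ∈ W` points to at least three targets (Lemma 5.3(b) feeds the candidate sets of
  `three_le_encard_setOf_points`, `TimarForestTargets.lean`);
* the forest is almost surely acyclic (`ae_isAcyclic_forest`, labels a.s. distinct), and
  `x` points to at most `deg_G x` targets (`ae_encard_fpoints_le`, from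
  `encard_setOf_points_le_degree`).

## References

* Á. Timár, *Percolation on nonunimodular transitive graphs*, Ann. Probab. 34 (2006)
  2344–2364 (arXiv:math/0702875), §5: Lemma 5.3 and its proof; proof of Thm. 5.5 (the digraph
  `M⃗`, "every point `x` in `F` has degree `≥ 3`"). [Timar2006]
* R. Lyons, Y. Peres, *Probability on Trees and Networks*, CUP 2016, §8.2 (tilted MTP).
  [LyonsPeres2016]
-/

noncomputable section

namespace Literature.Barriers.CriticalPhenomena

open _root_.MeasureTheory _root_.ProbabilityTheory _root_.Filter Literature.Probability.LatticeModels
  Literature.Probability.Percolation SimpleGraph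
open scoped ENNReal

variable {V : Type*}

/-! ### Deterministic preliminaries on the target forest -/

section Deterministic

variable {Γ : SimpleGraph V} {W : Set V} {R : V → V → Prop}

/-! #### The sender rule of Lemma 5.3(b) -/

/-- **The sender rule** of the proof of Lemma 5.3(b): `y` sends unit mass to `x` if `x ∈ W` is in
the class of `y`, `y ≠ x` lies in the cluster of `x`, and the branch of `y` at `x` contains no
point of `W` of that class ("let each vertex `y` contained in such a `C ∩ L₀` send mass `1` to
`x`"). [cite: Timar2006, Lemma 5.3 (proof)] -/
def Snd (Γ : SimpleGraph V) (W : Set V) (R : V → V → Prop) (y x : V) : Prop :=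
  x ∈ W ∧ R x y ∧ Γ.Reachable x y ∧ y ≠ x ∧ ∀ z, AvoidReach Γ x y z → z ∈ W → R x z → False

/-- Of two vertices `x ≠ x'`, a third vertex reaches one of them avoiding the other. [folklore] -/
theorem avoidReach_or_avoidReach {x x' : V} (hxx' : x ≠ x') :
    ∀ {y : V} (_ : Γ.Walk y x'), y ≠ x → y ≠ x' → AvoidReach Γ x y x' ∨ AvoidReach Γ x' y x
  | _, Walk.nil, _, hy' => absurd rfl hy'
  | y, Walk.cons (v := w) h π, hy, hy' => by
    have hedge : ∀ {a : V}, y ≠ a → w ≠ a → AvoidReach Γ a y w := fun hya hwa =>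
      ⟨Walk.cons h Walk.nil, by
        rw [Walk.support_cons, Walk.support_nil, List.mem_cons, List.mem_singleton, not_or]
        exact ⟨fun h => hya h.symm, fun h => hwa h.symm⟩⟩
    by_cases hw' : w = x'
    · subst hw'
      exact Or.inl (hedge hy hxx'.symm)
    by_cases hw : w = x
    · subst hw
      exact Or.inr (hedge hy' hxx')
    rcases avoidReach_or_avoidReach hxx' π hw hw' with h1 | h1
    · exact Or.inl ((hedge hy hw).trans h1)
    · exact Or.inr ((hedge hy' hw').trans h1)

/-- **A vertex sends mass to at most one point** ("the expected mass sent out is at most 1"), for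
a symmetric and transitive class relation. [cite: Timar2006, Lemma 5.3 (proof)] -/
theorem Snd.unique (hRs : ∀ {a b}, R a b → R b a) (hRt : ∀ {a b c}, R a b → R b c → R a c)
    {y x x' : V} (h : Snd Γ W R y x) (h' : Snd Γ W R y x') : x = x' := by
  by_contra hne
  obtain ⟨hxW, hRxy, -, hyx, hno⟩ := h
  obtain ⟨hx'W, hRx'y, hreach', hyx', hno'⟩ := h'
  obtain ⟨π⟩ := hreach'.symm
  rcases avoidReach_or_avoidReach hne π hyx hyx' with h1 | h1
  · exact hno x' h1 hx'W (hRt hRxy (hRs hRx'y))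
  · exact hno' x h1 hxW (hRt hRx'y (hRs hRxy))

end Deterministic

/-! ### The space of the forest: the percolation, its labels and the phase -/

/-- The space `Ω₁`: the coupling (percolation labels and tie-breaking labels) and the phase of the
1-partition. [cite: Timar2006, Thm. 5.5 (proof: "the 1-partition, the percolation and some additional randomness")] -/
abbrev ForestSpace (V : Type*) : Type _ := Coupling V × UnitAddCircle

/-- Its law: the coupling measure times the uniform phase. [cite: Timar2006, §5 ("Choose U ∈ [0,1] uniformly at random")] -/
def forestMeasure (V : Type*) : Measure (ForestSpace V) := (couplingMeasure V).prod volume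

/-- The law of `Ω₁` is a probability measure. [folklore] -/
instance isProbabilityMeasure_forestMeasure (V : Type*) : IsProbabilityMeasure (forestMeasure V) := by
  rw [forestMeasure]; infer_instance

section Defs

variable (G : SimpleGraph V) [G.LocallyFinite] (o : V) (p : ℝ)

/-- The diagonal action of `Aut(G)` on `Ω₁`: relabel the fields, rotate the phase.
[cite: Timar2006, Thm. 5.5 (proof: "equivariant")] -/
def forestAct (γ : G ≃g G) : ForestSpace V → ForestSpace V :=
  Prod.map (couplingAct γ) (onePartitionAct G o γ)

/-- The percolation configuration `ω = ω_p`. [folklore] -/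
def forestOmega (ξ : ForestSpace V) : BondConfig V := omegaAt G p ξ.1

/-- **`W`: the encounter points of the bad clusters.** [cite: Timar2006, Thm. 5.5 (proof: "the set W of encounter points of ω in L₀")] -/
def encPoints (ξ : ForestSpace V) : Set V :=
  {x | (IsHeavy G o (openCluster (forestOmega G p ξ) x) ∧ LevelBad G (forestOmega G p ξ) x) ∧
    IsEncounter G o (forestOmega G p ξ) x}

/-- "Same class of the 1-partition". [cite: Timar2006, §5 (the 1-partition)] -/
def SameCls (ξ : ForestSpace V) (x y : V) : Prop := OnePartitionRel G o ξ.2 x y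

/-- The tie-breaking label of a vertex (the second label field on the diagonal pair).
[cite: Timar2006, Thm. 5.5 (proof: "choose uniformly", "when breaking ties")] -/
def tieLabel (ξ : ForestSpace V) (v : V) : ℝ := ξ.1.2 s(v, v)

/-- The pointing relation `x → t` of the digraph `M⃗`. [cite: Timar2006, Thm. 5.5 (proof: the digraph M⃗)] -/
def FPoints (ξ : ForestSpace V) (x t : V) : Prop :=
  Points (openGraph (forestOmega G p ξ)) (encPoints G o p ξ) (SameCls G o ξ) (tieLabel ξ) x t

/-- The forest `M`. [cite: Timar2006, Thm. 5.5 (proof: "Denote by M the graph …")] -/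
def forest (ξ : ForestSpace V) : SimpleGraph V :=
  targetGraph (openGraph (forestOmega G p ξ)) (encPoints G o p ξ) (SameCls G o ξ) (tieLabel ξ)

/-- The sender rule on `Ω₁`. [cite: Timar2006, Lemma 5.3 (proof)] -/
def FSnd (ξ : ForestSpace V) (y x : V) : Prop :=
  Snd (openGraph (forestOmega G p ξ)) (encPoints G o p ξ) (SameCls G o ξ) y x

-- Maintenance 2026-08-20 (ops-buildfix G11-2 / Literature FQN clash #12): `sendTo`, `sendTo_eq_some_iff`,
-- `measurableSet_sendTo_eq_some` and `ae_infinite_branchSet_inter_class` live in the sub-namespace `Forest`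
-- (opened right below), because `TimarLemma53Targets.lean` declares the same four names for the
-- `BondConfig V × UnitAddCircle` formalisation and the two modules could not be imported together.
-- Statements and proofs are textually unchanged.
namespace Forest

open Classical in
/-- The recipient of the unit mass of `y`, if any. [cite: Timar2006, Lemma 5.3 (proof)] -/
def sendTo (ξ : ForestSpace V) (y : V) : Option V :=
  if h : ∃ x, FSnd G o p ξ y x then some h.choose else none

end Forest

end Defs

open Literature.Barriers.CriticalPhenomena.Forest

section Basic

variable {G : SimpleGraph V} [G.LocallyFinite] {o : V} {p : ℝ}

omit [G.LocallyFinite] in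
/-- `ω ⊆ E(G)` surely. [folklore] -/
theorem forestOmega_subset (ξ : ForestSpace V) : forestOmega G p ξ ⊆ G.edgeSet :=
  omegaAt_subset_edgeSet G p ξ.1

omit [G.LocallyFinite] in
/-- The open graph is a subgraph of `G`. [folklore] -/
theorem openGraph_forestOmega_le (ξ : ForestSpace V) : openGraph (forestOmega G p ξ) ≤ G := by
  intro a b hab
  rw [openGraph_adj] at hab
  have := forestOmega_subset ξ hab.1
  simpa [hab.2] using this

/-- `SameCls` is symmetric. [folklore] -/
theorem SameCls.symm {ξ : ForestSpace V} {x y : V} (h : SameCls G o ξ x y) : SameCls G o ξ y x :=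
  Eq.symm h

/-- `SameCls` is transitive. [folklore] -/
theorem SameCls.trans {ξ : ForestSpace V} {x y z : V} (h : SameCls G o ξ x y) (h' : SameCls G o ξ y z) :
    SameCls G o ξ x z :=
  Eq.trans h h'

/-- A pointing pair: the target is a point of `W`, in the class of `x`, in the cluster of `x`.
[folklore] -/
theorem FPoints.mem {ξ : ForestSpace V} {x t : V} (h : FPoints G o p ξ x t) :
    x ∈ encPoints G o p ξ ∧ t ∈ encPoints G o p ξ ∧ SameCls G o ξ x t ∧
      (openGraph (forestOmega G p ξ)).Reachable x t ∧ t ≠ x := by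
  obtain ⟨hx, u, ht⟩ := h
  exact ⟨hx, ht.1.2.2.1, ht.1.2.2.2, ht.1.2.1, ht.1.1.ne_right⟩

/-- A pointing pair is an edge of the forest. [folklore] -/
theorem FPoints.adj {ξ : ForestSpace V} {x t : V} (h : FPoints G o p ξ x t) : (forest G o p ξ).Adj x t :=
  ⟨h.mem.2.2.2.2.symm, Or.inl h⟩

namespace Forest

/-- `sendTo y = some x` iff `y` sends to `x` (the recipient is unique). [folklore] -/
private theorem sendTo_eq_some_iff {ξ : ForestSpace V} {y x : V} : sendTo G o p ξ y = some x ↔ FSnd G o p ξ y x := by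
  classical
  by_cases h : ∃ x', FSnd G o p ξ y x'
  · have hdef : sendTo G o p ξ y = some h.choose := by
      unfold sendTo
      rw [dif_pos h]
    rw [hdef, Option.some.injEq]
    constructor
    · rintro rfl
      exact h.choose_spec
    · intro hx
      exact Snd.unique (Γ := openGraph (forestOmega G p ξ)) (W := encPoints G o p ξ) (R := SameCls G o ξ)
        (fun h => SameCls.symm h) (fun h h' => SameCls.trans h h') h.choose_spec hx
  · have hdef : sendTo G o p ξ y = none := by
      unfold sendTo
      rw [dif_neg h]
    rw [hdef]
    simp only [reduceCtorEq, false_iff]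
    exact fun hx => h ⟨x, hx⟩

end Forest

end Basic

/-! ### Equivariance -/

section Equivariance

variable {G : SimpleGraph V} [G.LocallyFinite] {o : V} {p : ℝ}

/-- The action is measurable. [folklore] -/
theorem measurable_forestAct (γ : G ≃g G) : Measurable (forestAct G o γ) :=
  (measurable_couplingAct γ).prodMap (measurable_onePartitionAct γ)

/-- **The law of `Ω₁` is invariant.** [cite: Timar2006, Thm. 5.5 (proof: invariance)] -/
theorem forestMeasure_map_forestAct (γ : G ≃g G) :
    (forestMeasure V).map (forestAct G o γ) = forestMeasure V := by
  rw [forestMeasure, forestAct, ← Measure.map_prod_map _ _ (measurable_couplingAct γ)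
    (measurable_onePartitionAct γ), couplingMeasure_map_couplingAct,
    (measurePreserving_onePartitionAct (G := G) (o := o) γ).map_eq]

/-- `ω` is equivariant. [folklore] -/
theorem forestOmega_act (γ : G ≃g G) (ξ : ForestSpace V) :
    forestOmega G p (forestAct G o γ ξ) = BondConfig.relabel (sym2Equiv γ.toEquiv) (forestOmega G p ξ) :=
  omegaAt_couplingAct γ p ξ.1

/-- `W` is equivariant. [folklore] -/
theorem mem_encPoints_act_iff (hconn : G.Connected) (γ : G ≃g G) (ξ : ForestSpace V) (x : V) :
    γ x ∈ encPoints G o p (forestAct G o γ ξ) ↔ x ∈ encPoints G o p ξ := by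
  classical
  simp only [encPoints, Set.mem_setOf_eq]
  rw [forestOmega_act]
  have hC : openCluster (BondConfig.relabel (sym2Equiv γ.toEquiv) (forestOmega G p ξ)) (γ x) =
      (γ : V → V) '' openCluster (forestOmega G p ξ) x := openCluster_relabel γ.toEquiv _ x
  rw [hC, isHeavy_image_iff G hconn γ o, levelBad_relabel_iff γ _ x]
  exact and_congr_right fun _ => isEncounter_relabel_iff G hconn γ o _ x

/-- The class relation is equivariant. [folklore] -/
theorem sameCls_act_iff (hconn : G.Connected) (γ : G ≃g G) (ξ : ForestSpace V) (x y : V) :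
    SameCls G o (forestAct G o γ ξ) (γ x) (γ y) ↔ SameCls G o ξ x y :=
  onePartitionRel_act_iff hconn γ ξ.2 x y

/-- The labels are equivariant. [folklore] -/
theorem tieLabel_act (γ : G ≃g G) (ξ : ForestSpace V) (v : V) :
    tieLabel (forestAct G o γ ξ) (γ v) = tieLabel ξ v := by
  change ξ.1.2 (sym2Equiv γ.toEquiv.symm s(γ v, γ v)) = ξ.1.2 s(v, v)
  rw [sym2Equiv_mk]
  exact congrArg ξ.1.2
    (congrArg₂ (fun a b => s(a, b)) (γ.toEquiv.symm_apply_apply v) (γ.toEquiv.symm_apply_apply v))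

/-- The pointing relation is equivariant. [cite: Timar2006, Thm. 5.5 (proof: "equivariant")] -/
theorem fpoints_act_iff (hconn : G.Connected) (γ : G ≃g G) (ξ : ForestSpace V) (x t : V) :
    FPoints G o p (forestAct G o γ ξ) (γ x) (γ t) ↔ FPoints G o p ξ x t := by
  unfold FPoints
  rw [forestOmega_act]
  exact points_iso_iff (openGraphRelabelIso γ.toEquiv (forestOmega G p ξ))
    (Wset := encPoints G o p ξ) (Wset' := encPoints G o p (forestAct G o γ ξ))
    (R := SameCls G o ξ) (R' := SameCls G o (forestAct G o γ ξ))
    (ℓ := tieLabel ξ) (ℓ' := tieLabel (forestAct G o γ ξ))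
    (fun x => mem_encPoints_act_iff hconn γ ξ x) (fun x y => sameCls_act_iff hconn γ ξ x y)
    (fun x => tieLabel_act γ ξ x) x t

/-- The sender rule is equivariant. [folklore] -/
theorem fsnd_act_iff (hconn : G.Connected) (γ : G ≃g G) (ξ : ForestSpace V) (y x : V) :
    FSnd G o p (forestAct G o γ ξ) (γ y) (γ x) ↔ FSnd G o p ξ y x := by
  unfold FSnd Snd
  have hr : (openGraph (BondConfig.relabel (sym2Equiv γ.toEquiv) (forestOmega G p ξ))).Reachable (γ x) (γ y) ↔
      (openGraph (forestOmega G p ξ)).Reachable x y :=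
    reachable_relabel_iff γ.toEquiv _ x y
  rw [forestOmega_act, mem_encPoints_act_iff hconn, sameCls_act_iff hconn, hr, γ.injective.ne_iff]
  refine and_congr_right fun _ => and_congr_right fun _ => and_congr_right fun _ =>
    and_congr_right fun _ => ⟨fun h z hz hzW hR => ?_, fun h z' hz' hz'W hR' => ?_⟩
  · exact h (γ z) ((avoidReach_relabel_iff γ.toEquiv _ x y z).2 hz)
      ((mem_encPoints_act_iff hconn γ ξ z).2 hzW) ((sameCls_act_iff hconn γ ξ x z).2 hR)
  · obtain ⟨z, rfl⟩ : ∃ z, γ z = z' := ⟨γ.symm z', RelIso.apply_symm_apply γ z'⟩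
    exact h z ((avoidReach_relabel_iff γ.toEquiv _ x y z).1 hz')
      ((mem_encPoints_act_iff hconn γ ξ z).1 hz'W) ((sameCls_act_iff hconn γ ξ x z).1 hR')

/-- The recipient map is equivariant. [folklore] -/
theorem sendTo_act (hconn : G.Connected) (γ : G ≃g G) (ξ : ForestSpace V) (y : V) :
    sendTo G o p (forestAct G o γ ξ) (γ y) = (sendTo G o p ξ y).map γ := by
  rcases h : sendTo G o p ξ y with _ | x
  · rw [Option.map_none]
    by_contra hne
    obtain ⟨x', hx'⟩ := Option.ne_none_iff_exists'.1 hne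
    obtain ⟨x, rfl⟩ : ∃ x, γ x = x' := ⟨γ.symm x', RelIso.apply_symm_apply γ x'⟩
    rw [sendTo_eq_some_iff, fsnd_act_iff hconn, ← sendTo_eq_some_iff (G := G) (o := o) (p := p), h] at hx'
    cases hx'
  · rw [Option.map_some, sendTo_eq_some_iff, fsnd_act_iff hconn]
    exact sendTo_eq_some_iff.1 h

end Equivariance

/-! ### Measurability -/

section Measurability

variable {G : SimpleGraph V} [G.LocallyFinite] {o : V} {p : ℝ} [Countable V]

omit [G.LocallyFinite] [Countable V] in
/-- `ω` is measurable. [folklore] -/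
theorem measurable_forestOmega : Measurable (forestOmega G p : ForestSpace V → BondConfig V) :=
  (measurable_omegaAt G p).comp measurable_fst

omit [G.LocallyFinite] in
/-- Membership in `W` is a measurable event. [folklore] -/
theorem measurableSet_mem_encPoints (x : V) : MeasurableSet {ξ : ForestSpace V | x ∈ encPoints G o p ξ} :=
  ((measurableSet_isHeavy_and_levelBad G o x).inter (measurableSet_isEncounter G o x)).preimage
    measurable_forestOmega

omit [Countable V] in
/-- The class relation is a measurable event. [folklore] -/
theorem measurableSet_sameCls (x y : V) : MeasurableSet {ξ : ForestSpace V | SameCls G o ξ x y} :=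
  (measurableSet_setOf_onePartitionRel x y).preimage measurable_snd

omit [G.LocallyFinite] [Countable V] in
/-- The labels are measurable. [folklore] -/
theorem measurable_tieLabel (v : V) : Measurable fun ξ : ForestSpace V => tieLabel ξ v :=
  (measurable_pi_apply _).comp (measurable_snd.comp measurable_fst)

omit [G.LocallyFinite] [Countable V] in
/-- Adjacency in the open graph is a measurable event. [folklore] -/
theorem measurableSet_openGraph_forestOmega_adj (a b : V) :
    MeasurableSet {ξ : ForestSpace V | (openGraph (forestOmega G p ξ)).Adj a b} :=
  measurableSet_openGraph_adj_comp measurable_forestOmega a b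

/-- The pointing relation is a measurable event. [cite: Timar2006, Thm. 5.5 (proof: the graphs are functions of the percolation and the extra randomness)] -/
theorem measurableSet_fpoints (x t : V) : MeasurableSet {ξ : ForestSpace V | FPoints G o p ξ x t} :=
  measurableSet_points measurableSet_openGraph_forestOmega_adj measurableSet_mem_encPoints
    measurableSet_sameCls measurable_tieLabel x t

/-- The sender rule is a measurable event. [folklore] -/
theorem measurableSet_fsnd (y x : V) : MeasurableSet {ξ : ForestSpace V | FSnd G o p ξ y x} := by
  have h : {ξ : ForestSpace V | FSnd G o p ξ y x} = {ξ | x ∈ encPoints G o p ξ} ∩ ({ξ | SameCls G o ξ x y} ∩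
      ({ξ | (openGraph (forestOmega G p ξ)).Reachable x y} ∩ ({_ξ | y ≠ x} ∩
        ⋂ z, ({ξ | AvoidReach (openGraph (forestOmega G p ξ)) x y z}ᶜ ∪ ({ξ | z ∈ encPoints G o p ξ}ᶜ ∪
          {ξ | SameCls G o ξ x z}ᶜ))))) := by
    ext ξ
    simp only [FSnd, Snd, Set.mem_setOf_eq, Set.mem_inter_iff, Set.mem_iInter, Set.mem_union,
      Set.mem_compl_iff]
    refine and_congr_right fun _ => and_congr_right fun _ => and_congr_right fun _ =>
      and_congr_right fun _ => forall_congr' fun z => ?_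
    tauto
  rw [h]
  refine (measurableSet_mem_encPoints x).inter ((measurableSet_sameCls x y).inter
    (((measurableSet_openConn_holds x y).preimage measurable_forestOmega).inter
      ((MeasurableSet.const _).inter (MeasurableSet.iInter fun z => ?_))))
  exact ((measurableSet_avoidReach x y z).preimage measurable_forestOmega).compl.union
    ((measurableSet_mem_encPoints z).compl.union (measurableSet_sameCls x z).compl)

namespace Forest

/-- The recipient events are measurable. [folklore] -/
private theorem measurableSet_sendTo_eq_some (y x : V) :
    MeasurableSet {ξ : ForestSpace V | sendTo G o p ξ y = some x} := by
  simp_rw [sendTo_eq_some_iff]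
  exact measurableSet_fsnd y x

end Forest

/-- "An infinite set of vertices satisfies the property" is measurable when membership is.
[folklore] -/
theorem measurableSet_setOf_infinite {Ω : Type*} [MeasurableSpace Ω] {A : Ω → Set V}
    (hA : ∀ v, MeasurableSet {ξ | v ∈ A ξ}) : MeasurableSet {ξ | (A ξ).Infinite} := by
  have h : {ξ | (A ξ).Infinite} = ⋂ F : Finset V, ⋃ v ∈ (↑F : Set V)ᶜ, {ξ | v ∈ A ξ} := by
    ext ξ
    simp only [Set.mem_setOf_eq, Set.mem_iInter, Set.mem_iUnion, Set.mem_compl_iff, Finset.mem_coe,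
      exists_prop]
    constructor
    · intro hinf F
      obtain ⟨v, hv, hvF⟩ := hinf.exists_notMem_finset F
      exact ⟨v, hvF, hv⟩
    · intro h hfin
      obtain ⟨v, hvF, hv⟩ := h hfin.toFinset
      exact hvF (hfin.mem_toFinset.2 hv)
  rw [h]
  exact MeasurableSet.iInter fun F => MeasurableSet.biUnion (Set.to_countable _) fun v _ => hA v

end Measurability

/-! ### "C ∩ L₀ is infinite (by deletion tolerance and Lemma 5.2)" on Ω₁ -/

section SlabOmega

variable {G : SimpleGraph V} [G.LocallyFinite]

/-- **Weights inside a class of the 1-partition differ by a factor at most `μ = Δ⁻¹`.**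
[cite: Timar2006, Thm. 5.5 (proof: "the weights of the vertices will have bounded logarithms")] -/
theorem autWeight_le_of_onePartitionRel (hconn : G.Connected) (ht : IsGraphTransitive G)
    (hU : ¬ IsGraphUnimodular G) {o : V} {θ : UnitAddCircle} {x y : V} (h : OnePartitionRel G o θ x y) :
    autWeight G o y ≤ (minNbrWeight G o)⁻¹ * autWeight G o x := by
  have hy : y ∈ {y | OnePartitionRel G o θ x y} := h
  have hx : x ∈ {y | OnePartitionRel G o θ x y} := (onePartitionRel_equivalence G o θ).refl x
  rw [setOf_onePartitionRel_eq_weightSlab hconn ht hU θ x] at hx hy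
  set b := oneClassTop G o θ (oneIndex G o θ x) with hb
  have h0 := minNbrWeight_ne_zero hconn o
  have hT := minNbrWeight_ne_top hconn ht hU o
  calc autWeight G o y ≤ b := hy.2
    _ = (minNbrWeight G o)⁻¹ * (minNbrWeight G o * b) := by
        rw [← mul_assoc, ENNReal.inv_mul_cancel h0 hT, one_mul]
    _ ≤ (minNbrWeight G o)⁻¹ * autWeight G o x := mul_le_mul' le_rfl hx.1.le

/-- For a fixed phase, almost surely every heavy branch meets every class infinitely often.
[cite: Timar2006, Lemma 5.3 (proof: "C ∩ L₀ is infinite")] -/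
theorem ae_coupling_infinite_branchSet_inter_class (hconn : G.Connected) (ht : IsGraphTransitive G)
    (hU : ¬ IsGraphUnimodular G) {p : unitInterval} (hp0 : 0 < (p : ℝ)) (hp1 : (p : ℝ) < 1) (o : V)
    (θ : UnitAddCircle) :
    ∀ᵐ c ∂(couplingMeasure V), ∀ (x' x u : V), IsHeavy G o (branchSet (omegaAt G p c) x u) →
      (branchSet (omegaAt G p c) x u ∩ {v | OnePartitionRel G o θ x' v}).Infinite := by
  haveI : Countable V := countable_of_connected_of_locallyFinite G hconn o
  rw [ae_all_iff]
  intro x'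
  have h := ae_infinite_branchSet_inter_weightSlab hconn ht hU hp0 hp1 o
    (a := minNbrWeight G o * oneClassTop G o θ (oneIndex G o θ x'))
    (b := oneClassTop G o θ (oneIndex G o θ x')) le_rfl
    (oneClassTop_ne_zero hconn ht hU θ _) (oneClassTop_ne_top θ _)
  rw [setOf_onePartitionRel_eq_weightSlab hconn ht hU θ x']
  exact ae_omegaAt G p h

namespace Forest

/-- **Almost surely on `Ω₁`, every heavy branch meets every class of the 1-partition in infinitely
many vertices** (Fubini over the phase). [cite: Timar2006, Lemma 5.3 (proof: "C ∩ L₀ is infinite (by deletion tolerance and Lemma 5.2)")] -/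
theorem ae_infinite_branchSet_inter_class (hconn : G.Connected) (ht : IsGraphTransitive G)
    (hU : ¬ IsGraphUnimodular G) {p : unitInterval} (hp0 : 0 < (p : ℝ)) (hp1 : (p : ℝ) < 1) (o : V) :
    ∀ᵐ ξ ∂(forestMeasure V), ∀ (x' x u : V), IsHeavy G o (branchSet (forestOmega G p ξ) x u) →
      (branchSet (forestOmega G p ξ) x u ∩ {v | SameCls G o ξ x' v}).Infinite := by
  haveI : Countable V := countable_of_connected_of_locallyFinite G hconn o
  have hE : MeasurableSet {q : Coupling V × UnitAddCircle | ∀ (x' x u : V),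
      IsHeavy G o (branchSet (omegaAt G p q.1) x u) →
        (branchSet (omegaAt G p q.1) x u ∩ {v | OnePartitionRel G o q.2 x' v}).Infinite} := by
    have h : {q : Coupling V × UnitAddCircle | ∀ (x' x u : V),
        IsHeavy G o (branchSet (omegaAt G p q.1) x u) →
          (branchSet (omegaAt G p q.1) x u ∩ {v | OnePartitionRel G o q.2 x' v}).Infinite} =
        ⋂ x' : V, ⋂ x : V, ⋂ u : V, ({q | IsHeavy G o (branchSet (omegaAt G p q.1) x u)}ᶜ ∪
          {q | (branchSet (omegaAt G p q.1) x u ∩ {v | OnePartitionRel G o q.2 x' v}).Infinite}) := by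
      ext q
      simp only [Set.mem_setOf_eq, Set.mem_iInter, Set.mem_union, Set.mem_compl_iff, imp_iff_not_or]
    rw [h]
    refine MeasurableSet.iInter fun x' => MeasurableSet.iInter fun x => MeasurableSet.iInter fun u => ?_
    refine ((measurableSet_isHeavy_branchSet G o x u).preimage
      ((measurable_omegaAt G _).comp measurable_fst)).compl.union (measurableSet_setOf_infinite fun v => ?_)
    exact ((measurableSet_avoidReach x u v).preimage ((measurable_omegaAt G _).comp measurable_fst)).inter
      ((measurableSet_setOf_onePartitionRel x' v).preimage measurable_snd)
  change ∀ᵐ ξ ∂((couplingMeasure V).prod volume), ξ ∈ {q : Coupling V × UnitAddCircle | ∀ (x' x u : V),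
      IsHeavy G o (branchSet (omegaAt G p q.1) x u) →
        (branchSet (omegaAt G p q.1) x u ∩ {v | OnePartitionRel G o q.2 x' v}).Infinite}
  rw [Measure.ae_prod_mem_iff_ae_ae_mem hE]
  refine (Measure.ae_ae_comm (p := fun (c : Coupling V) (θ : UnitAddCircle) => ∀ (x' x u : V),
      IsHeavy G o (branchSet (omegaAt G p c) x u) →
        (branchSet (omegaAt G p c) x u ∩ {v | OnePartitionRel G o θ x' v}).Infinite) hE).2 ?_
  exact ae_of_all _ fun θ => ae_coupling_infinite_branchSet_inter_class hconn ht hU hp0 hp1 o θ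

end Forest

end SlabOmega

/-! ### Lemma 5.3(b): heavy branches at an encounter point contain encounter points of its class -/

section LemmaFiveThree

variable {G : SimpleGraph V} [G.LocallyFinite]

/-- The fibres of the sender rule are almost surely finite (the MTP of the proof of Lemma 5.3:
"The expected mass sent out is at most 1", weights inside a class within a factor `Δ⁻¹`).
[cite: Timar2006, Lemma 5.3 (proof: MTP)] -/
theorem ae_finite_fiber_sendTo (hconn : G.Connected) (ht : IsGraphTransitive G)
    (hU : ¬ IsGraphUnimodular G) (p : ℝ) (o : V) :
    ∀ᵐ ξ ∂(forestMeasure V), ∀ x, {y | sendTo G o p ξ y = some x}.Finite := by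
  haveI : Countable V := countable_of_connected_of_locallyFinite G hconn o
  refine ae_finite_fiber hconn ht (forestMeasure V) (forestAct G o) (fun γ => measurable_forestAct γ)
    (fun γ => forestMeasure_map_forestAct γ) (τ := fun ξ y => sendTo G o p ξ y)
    (fun y x => measurableSet_sendTo_eq_some y x) (fun γ ξ y => sendTo_act hconn γ ξ y) o
    (B := (minNbrWeight G o)⁻¹) (ENNReal.inv_ne_top.2 (minNbrWeight_ne_zero hconn o)) ?_
  intro ξ y x hyx
  rw [sendTo_eq_some_iff] at hyx
  exact autWeight_le_of_onePartitionRel hconn ht hU ((onePartitionRel_equivalence G o ξ.2).symm hyx.2.1)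

/-- **Timár 2006, Lemma 5.3(b), PROVED** (for the encounter points of the bad clusters and the
classes of the 1-partition): almost surely, for every `x ∈ W` and every `u` in the cluster of `x`
whose branch `C` at `x` is heavy, `C` contains a point of `W` in the class of `x` ("for any
encounter point `x ∈ L₀ ∩ ω` and any open heavy component `C` in `ω ∖ {x}` that is adjacent to
`x` in `ω`, `C ∩ L₀` contains some vertex that is an encounter point for `ω`"). Proof as printed:
otherwise every `y ∈ C ∩ L₀` sends unit mass to `x`; `C ∩ L₀` is infinite, the fibres are finite.
[cite: Timar2006, Lemma 5.3] -/
theorem ae_exists_encPoint_in_branch (hconn : G.Connected) (ht : IsGraphTransitive G)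
    (hU : ¬ IsGraphUnimodular G) {p : unitInterval} (hp0 : 0 < (p : ℝ)) (hp1 : (p : ℝ) < 1) (o : V) :
    ∀ᵐ ξ ∂(forestMeasure V), ∀ x ∈ encPoints G o p ξ, ∀ u, (openGraph (forestOmega G p ξ)).Reachable x u →
      IsHeavy G o (branchSet (forestOmega G p ξ) x u) →
        ∃ z ∈ encPoints G o p ξ, AvoidReach (openGraph (forestOmega G p ξ)) x u z ∧ SameCls G o ξ x z := by
  filter_upwards [ae_finite_fiber_sendTo hconn ht hU (p : ℝ) o,
    ae_infinite_branchSet_inter_class hconn ht hU hp0 hp1 o] with ξ hfin hW3 x hx u hxu hH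
  by_contra hno
  push Not at hno
  refine hW3 x x u hH ((hfin x).subset ?_)
  rintro y ⟨hyβ, hycls⟩
  rw [Set.mem_setOf_eq, sendTo_eq_some_iff]
  refine ⟨hx, hycls, hxu.trans hyβ.reachable, hyβ.ne_right, fun z hz hzW hcls => ?_⟩
  exact hno z hzW (hyβ.trans hz) hcls

end LemmaFiveThree

/-! ### Degree at least three, acyclicity -/

section Degree

variable {G : SimpleGraph V} [G.LocallyFinite]

/-- **"Every point `x` in `F` has degree `≥ 3`", PROVED**: almost surely every `x ∈ W` points to at
least three targets. [cite: Timar2006, Thm. 5.5 (proof: "every point x in F has degree ≥ 3 because each element of W is incident to at least one edge for each infinite component …")] -/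
theorem ae_three_le_encard_fpoints (hconn : G.Connected) (ht : IsGraphTransitive G)
    (hU : ¬ IsGraphUnimodular G) {p : unitInterval} (hp0 : 0 < (p : ℝ)) (hp1 : (p : ℝ) < 1) (o : V) :
    ∀ᵐ ξ ∂(forestMeasure V), ∀ x ∈ encPoints G o p ξ,
      (3 : ℕ∞) ≤ ({t | FPoints G o p ξ x t} : Set V).encard := by
  filter_upwards [ae_exists_encPoint_in_branch hconn ht hU hp0 hp1 o] with ξ hW2 x hx
  obtain ⟨u, hu, hsep, hheavy⟩ := hx.2
  refine three_le_encard_setOf_points (openGraph_forestOmega_le ξ) hx u hsep fun i => ?_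
  obtain ⟨z, hzW, hz, hcls⟩ := hW2 x hx (u i) (hu i) (hheavy i)
  exact ⟨z, hz, (hu i).trans hz.reachable, hzW, hcls⟩

/-- The labels are almost surely pairwise distinct. [folklore] -/
theorem ae_injective_tieLabel [Countable V] :
    ∀ᵐ ξ ∂(forestMeasure V), Function.Injective (tieLabel (V := V) ξ) := by
  have h1 : ∀ᵐ c ∂(couplingMeasure V), Function.Injective c.2 := ae_snd_couplingMeasure ae_injective_labelMeasure
  have h2 : ∀ᵐ ξ ∂(forestMeasure V), Function.Injective ξ.1.2 :=
    (Measure.quasiMeasurePreserving_fst (μ := couplingMeasure V) (ν := (volume : Measure UnitAddCircle))).ae h1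
  filter_upwards [h2] with ξ hξ v w hvw
  have := hξ hvw
  rw [Sym2.eq_iff] at this
  tauto

/-- **The forest `M` is almost surely acyclic** (labels distinct; `targetGraph_isAcyclic`).
[cite: Timar2006, Thm. 5.5 (proof: "we obtain a forest F")] -/
theorem ae_isAcyclic_forest [Countable V] {o : V} {p : ℝ} :
    ∀ᵐ ξ ∂(forestMeasure V), (forest G o p ξ).IsAcyclic := by
  filter_upwards [ae_injective_tieLabel (V := V)] with ξ hξ
  exact targetGraph_isAcyclic (fun h => SameCls.symm h) (fun h h' => SameCls.trans h h') (hξ.injOn)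

/-- **Almost surely every vertex points to at most `deg_G` targets.** [cite: Timar2006, Thm. 5.5 (proof: one edge per component)] -/
theorem ae_encard_fpoints_le [Countable V] {o : V} {p : ℝ} :
    ∀ᵐ ξ ∂(forestMeasure V), ∀ x, ({t | FPoints G o p ξ x t} : Set V).encard ≤ (G.degree x : ℕ∞) := by
  filter_upwards [ae_injective_tieLabel (V := V)] with ξ hξ x
  exact encard_setOf_points_le_degree (openGraph_forestOmega_le ξ) (hξ.injOn) x

end Degree

end Literature.Barriers.CriticalPhenomena

end
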